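import Summits.MatrixMultiplication.MatrixMultiplication.Theorems.ObstructionDescentSchurWeylFormat
import Summits.MatrixMultiplication.MatrixMultiplication.Theorems.ObstructionDescentSecantGeneration

set_option linter.dupNamespace false
set_option autoImplicit false

/-!
# Obstruction descent — the window of `P_O` in BORDER-rank terms (decomp-mm · lens 3 · gen 29, def-free)

`route-MatrixMultiplication-ObstructionDescent`, crux `NoOccurrenceObstruction` (`P_O`, stmt 29040); NODE-g29 §5.

§1  **Full ideal containment is border rank (Alder).**  For a tensor `t` of format `m`:
    `I(GL_m³·⟨m⟩) ⊆ I(GL_m³·t)  ⟺  bR(t) ≤ m`  (`orbitVanishing_unitTensor_le_iff_algBorderRank_le`).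
    ⟸ is the elementary inclusion `{bR ≤ m} ⊆ σ_m` plus `GL³`-invariance of `bR`; ⟹ evaluates at the identity and invokes Alder's
    theorem `σ_m = {bR ≤ m}` (tree `algBorderRank_le_of_zeroLocus`).  `P_O` compares the two ideals only TYPE BY TYPE on whole
    highest-weight spaces — the occurrence shadow of this containment.
§2  **The padded tensor has the border rank of `⟨n,n,n⟩`** (`algBorderRank_padMM`).
§3  **`P_O` holds at every format above the border rank**: `bR(⟨n,n,n⟩) ≤ m ⟹` the instance of `P_O` at `(n,m)`, in both languages
    (`hwvSpace_le_orbitVanishing_padMM_of_algBorderRank_le`, `semigroup_containment_of_algBorderRank_le`) — sharpening the landed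
    rank version `semigroup_containment_of_tensorRank_le`.  Hence the CONTENT of `P_O` is exactly the window
    `n^τ ≤ m < bR(⟨n,n,n⟩)`; by [BI13] occurrence obstructions exist up to `m < 3n²/2 − 2`, so the window's lower part is
    genuinely obstructed at the quadratic scale and `P_O` asserts nothing there (it speaks of `m ≥ n^τ`, `τ > 2`, eventually).
§4  `P_O` from border rank eventually quadratic (`noOccurrenceObstruction_of_algBorderRank_eventually`).
No proposition is defined; no `def`; sorry-free; standard axioms.  Nothing here proves `ω = 2` or closes an item.
[cite: BurgisserClausenShokrollahi1997, Thm. (20.3), (20.24)] [cite: BurgisserIkenmeyer2011, §3.1, §5] [cite: BurgisserIkenmeyer2013, Thm. 1]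
-/

noncomputable section

open scoped BigOperators

namespace Summit.MatrixMultiplication.MatrixMultiplication.Theorems.ObstructionCalculus

open Literature.Computability.AlgebraicComplexity (actTensor actTensor_one kroneckerPow isotypicSum₁ isotypicSum₂ isotypicSum₃
  matMulTensor unitTensor tensorRank algBorderRank algBorderRank_le_tensorRank TensorRestrictsTo tensorRestrictsTo_actTensor)
open Summit.MatrixMultiplication.MatrixMultiplication.Theses.ObstructionDescent (NoOccurrenceObstruction)
open Summit.MatrixMultiplication.MatrixMultiplication.Theorems.ObstructionDescentInformationAxis
  (noOccurrenceObstruction_iff)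
open Summit.MatrixMultiplication.MatrixMultiplication.Theorems.ObstructionDescentSecantGeneration
  (mem_orbitVanishing_unitTensor_iff_rank zeroLocus_of_algBorderRank_le algBorderRank_le_of_zeroLocus algBorderRank_matMul_le_padMM)

variable {m : ℕ}

/-! ## §1 Full ideal containment ⟺ border rank -/

/-- `bR` is `GL³`-sub-invariant: `bR((A,B,C)·t) ≤ bR(t)` (a restriction). [cite: Blaser2013, Lemma 5.4] -/
theorem algBorderRank_actTensor_le (A B C : Matrix (Fin m) (Fin m) ℂ) (t : Tensor ℂ m) :
    algBorderRank (actTensor A B C t) ≤ algBorderRank t :=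
  (tensorRestrictsTo_actTensor A B C t).algBorderRank_le

/-- **⟸ (elementary):** if `bR(t) ≤ m` then every polynomial vanishing on `GL_m³·⟨m⟩` vanishes on `GL_m³·t`
(`{bR ≤ m} ⊆ σ_m`, and the orbit of `t` stays in `{bR ≤ m}`). [cite: BurgisserClausenShokrollahi1997, Thm. (20.24) (proof)] -/
theorem orbitVanishing_unitTensor_le_of_algBorderRank_le {t : Tensor ℂ m} (ht : algBorderRank t ≤ m) :
    orbitVanishing (unitTensor ℂ m) ≤ orbitVanishing t := by
  intro f hf
  rw [mem_orbitVanishing]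
  intro A B C _ _ _
  exact zeroLocus_of_algBorderRank_le ((algBorderRank_actTensor_le A B C t).trans ht) f
    (mem_orbitVanishing_unitTensor_iff_rank.1 hf)

/-- **⟹ (Alder):** if every polynomial vanishing on `GL_m³·⟨m⟩` vanishes on `GL_m³·t`, then `bR(t) ≤ m` (evaluate at the identity;
`σ_m = {bR ≤ m}`). [cite: BurgisserClausenShokrollahi1997, Thm. (20.3) (Alder)] -/
theorem algBorderRank_le_of_orbitVanishing_unitTensor_le {t : Tensor ℂ m}
    (h : orbitVanishing (unitTensor ℂ m) ≤ orbitVanishing t) : algBorderRank t ≤ m := by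
  refine algBorderRank_le_of_zeroLocus fun f hf => ?_
  have hft : f ∈ orbitVanishing t := h (mem_orbitVanishing_unitTensor_iff_rank.2 hf)
  have h1 := (mem_orbitVanishing.1 hft) 1 1 1 (by simp) (by simp) (by simp)
  rwa [actTensor_one] at h1

/-- **Full ideal containment is border rank**: `I(GL_m³·⟨m⟩) ⊆ I(GL_m³·t) ⟺ bR(t) ≤ m`.  (`P_O` is the type-wise occurrence
shadow of the left side for `t = pad_m⟨n,n,n⟩`; the left side itself, eventually at `m ≥ n^τ`, is border rank eventually
quadratic, i.e. summit-strength by Bini.) [cite: BurgisserClausenShokrollahi1997, Thm. (20.3), Thm. (20.24)] -/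
theorem orbitVanishing_unitTensor_le_iff_algBorderRank_le {t : Tensor ℂ m} :
    orbitVanishing (unitTensor ℂ m) ≤ orbitVanishing t ↔ algBorderRank t ≤ m :=
  ⟨algBorderRank_le_of_orbitVanishing_unitTensor_le, orbitVanishing_unitTensor_le_of_algBorderRank_le⟩

/-! ## §2 The padded tensor has the border rank of `⟨n,n,n⟩` -/

/-- `pad_m⟨n,n,n⟩` is a restriction of `⟨n,n,n⟩` (it is `(E,E,E)·⟨n,n,n⟩` for the 0/1 embedding matrices).
[cite: BurgisserIkenmeyer2011, §2] -/
theorem tensorRestrictsTo_matMul_padMM {n : ℕ} (h : n * n ≤ m) :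
    TensorRestrictsTo (matMulTensor ℂ n n n) (padMM ℂ n m h) := by
  classical
  unfold padMM
  rw [padTensor_eq_actTensor_ind]
  exact tensorRestrictsTo_actTensor _ _ _ _

/-- **`bR(pad_m⟨n,n,n⟩) = bR(⟨n,n,n⟩)`.** [cite: Blaser2013, Lemma 5.4] -/
theorem algBorderRank_padMM {n : ℕ} (h : n * n ≤ m) :
    algBorderRank (padMM ℂ n m h) = algBorderRank (matMulTensor ℂ n n n) :=
  le_antisymm (tensorRestrictsTo_matMul_padMM h).algBorderRank_le (algBorderRank_matMul_le_padMM h)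

/-! ## §3 `P_O` holds at every format above the border rank -/

/-- **Calculus form.**  If `bR(⟨n,n,n⟩) ≤ m` (`n² ≤ m`) then EVERY polynomial vanishing on `GL_m³·⟨m⟩` vanishes on
`GL_m³·pad_m⟨n,n,n⟩` — in particular every type does: the instance of `P_O` at `(n,m)`. [cite: BurgisserIkenmeyer2011, §3.1, §5] -/
theorem hwvSpace_le_orbitVanishing_padMM_of_algBorderRank_le {n : ℕ} (h : n * n ≤ m)
    (hbr : algBorderRank (matMulTensor ℂ n n n) ≤ m) (Λ : Fin 3 → Fin m → ℕ) (d : ℕ)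
    (hΛ : hwvSpace Λ d ≤ orbitVanishing (unitTensor ℂ m)) : hwvSpace Λ d ≤ orbitVanishing (padMM ℂ n m h) :=
  hΛ.trans (orbitVanishing_unitTensor_le_of_algBorderRank_le ((algBorderRank_padMM h).le.trans hbr))

/-- **Semigroup form.**  If `bR(⟨n,n,n⟩) ≤ m` (`n² ≤ m`) then `S(⟨n,n,n⟩) ⊆ S(⟨m⟩)`: every triple occurring in `⟨n,n,n⟩^{⊗d}` occurs
in `⟨m⟩^{⊗d}` — sharpening `semigroup_containment_of_tensorRank_le` from rank to border rank.  So the content of `P_O` is the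
window `n^τ ≤ m < bR(⟨n,n,n⟩)`. [cite: BurgisserIkenmeyer2011, §3.1, §5] -/
theorem semigroup_containment_of_algBorderRank_le (n m : ℕ) (h : n * n ≤ m)
    (hbr : algBorderRank (matMulTensor ℂ n n n) ≤ m) {d : ℕ} (lam : Fin 3 → Nat.Partition d)
    (hocc : isotypicSum₁ (lam 0) (isotypicSum₂ (lam 1) (isotypicSum₃ (lam 2)
      (kroneckerPow (matMulTensor ℂ n n n) d))) ≠ 0) :
    isotypicSum₁ (lam 0) (isotypicSum₂ (lam 1) (isotypicSum₃ (lam 2) (kroneckerPow (unitTensor ℂ m) d))) ≠ 0 :=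
  (hwvSpace_le_imp_iff_semigroup_containment n m h).1
    (fun Λ d hΛ => hwvSpace_le_orbitVanishing_padMM_of_algBorderRank_le h hbr Λ d hΛ) d lam hocc

/-- The rank version is the special case `bR ≤ R`. [cite: BurgisserIkenmeyer2011, §3.1] -/
theorem hwvSpace_le_orbitVanishing_padMM_of_tensorRank_le' {n : ℕ} (h : n * n ≤ m)
    (hr : tensorRank (matMulTensor ℂ n n n) ≤ m) (Λ : Fin 3 → Fin m → ℕ) (d : ℕ)
    (hΛ : hwvSpace Λ d ≤ orbitVanishing (unitTensor ℂ m)) : hwvSpace Λ d ≤ orbitVanishing (padMM ℂ n m h) :=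
  hwvSpace_le_orbitVanishing_padMM_of_algBorderRank_le h ((algBorderRank_le_tensorRank _).trans hr) Λ d hΛ

/-! ## §4 `P_O` from border rank eventually quadratic -/

/-- **`bR(⟨n,n,n⟩) ≤ n^{2+o(1)}` ⟹ `P_O`.**  If for every `τ > 2` eventually `bR(⟨n,n,n⟩) ≤ n^τ`, then `NoOccurrenceObstruction`:
at `m ≥ n^τ ≥ bR` the instance holds by §3.  (Over `ℂ` the hypothesis is summit-strength by Bini's theorem; the point of the
kernel is the placement of `P_O`'s window strictly below `bR`.) [cite: BurgisserIkenmeyer2011, §5] [cite: Blaser2013, Thm. 6.6] -/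
theorem noOccurrenceObstruction_of_algBorderRank_eventually
    (hbr : ∀ τ : ℝ, 2 < τ → ∃ n₀ : ℕ, ∀ n : ℕ, n₀ ≤ n → (algBorderRank (matMulTensor ℂ n n n) : ℝ) ≤ (n : ℝ) ^ τ) :
    NoOccurrenceObstruction := by
  rw [noOccurrenceObstruction_iff]
  intro τ hτ
  obtain ⟨n₀, hn₀⟩ := hbr τ hτ
  refine ⟨n₀, fun n m hn h hτm Λ d hΛ => ?_⟩
  have hbm : algBorderRank (matMulTensor ℂ n n n) ≤ m := by
    exact_mod_cast ((hn₀ n hn).trans hτm)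
  exact hwvSpace_le_orbitVanishing_padMM_of_algBorderRank_le h hbm Λ d hΛ

end Summit.MatrixMultiplication.MatrixMultiplication.Theorems.ObstructionCalculus

end
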